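import Summits.HodgeConjecture.HodgeConjecture.Theorems.R90S3CMOfTotNegRadicand   -- ★ P7 (K2E3-p17): §5 transport kit (`algEquiv_ofRingEquiv_rat_apply`, norm ∕ minpoly ∕ integrality ∕ signs)
import HarnessLib

/-!
# R90-TF · S3 · THEOREMS — `R90S3PlantedTransportAlongEquiv` ((U3-F) split, B9∕B10 glue, form β): the small ring-isomorphism kit that re-bases the planting
# data (dense embeddings, pinnings, the planted root, the degree, the non-square radicand) from `F′ = ℚ(α)` onto `L′⁺` along `e : F′ ≃+* L′⁺`

R90-TF section S3 (successor dealer R90-C12-plan (g2), deal 2026-09-05T01:18:23Z «B9 glue at `L′⁺` → K2E3-p21»; captain K2E3-p17 (g11)'s skeleton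
`R90/S3/SKELETON-P8-AuxGlobaliseField.K2E3-p17-g11.md` §B9∕§B10 («run B7–B9 on `L′⁺` directly via `J₀ ∘ e⁻¹`»); census R90 bus 01:19:26Z, form β); crux H413
(`stmt-HodgeConjecture-24833`, lane `--supports … --as helper`), route `HCCMUnconditional`.  ★ P7 §5 already moves norm, minimal polynomial, integrality and the
signs at the embeddings along ANY ring isomorphism `e`; Mathlib `NumberField.RingOfIntegers.mapRingEquiv_apply` moves the integral element (`(mapRingEquiv e x : F₂) = e x`).
This file adds the remaining pieces so that every ★ brick stated over an arbitrary number field (P1 pinning, P5 units off `p`, P8c∕P8d unramifiedness, P9′ exhaustion)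
is applied ON `L′⁺` with `J ∘ e⁻¹` and `α′ = mapRingEquiv e α` — no transport of `HeightOneSpectrum` is ever needed.  THEOREMS ONLY (no `def`, no `instance`, no notation,
no named fact, no `sorry`); ★∕Mathlib imports only; never imports `Cruxes/…/Lines`.

THE MATHEMATICS [folklore; Neukirch1999 Ch. II (8.1) for the dense embeddings].  For a ring isomorphism `e : F ≃ F₂`: a dense `J : F → K′` stays dense as `J ∘ e⁻¹`
(same range) and `(J ∘ e⁻¹)(e x) = J x`; `aeval (e x) g = e (aeval x g)` for `g ∈ ℤ[X]` or `ℚ[X]`, so roots move; `[F₂ : ℚ] = [F : ℚ]`; and a square root `θ` of a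
NON-SQUARE `γ ∈ F` inside an `F`-algebra `K` is not in the image of `F` (★ P8c's `hδF`, with ★ P7 §3 `forall_sq_ne_of_forall_re_neg` for a totally negative `γ`).
* §1 `range_comp_ringEquiv_symm`, **`denseRange_comp_ringEquiv_symm`**, `comp_ringEquiv_symm_apply`; §2 `aeval_int_ringEquiv_apply`, `aeval_int_ringEquiv_apply_eq_zero_iff`,
  `aeval_rat_ringEquiv_apply`, `isRoot_map_ringEquiv_iff`; §3 `finrank_rat_eq_of_ringEquiv`; §4 **`not_mem_range_algebraMap_of_sq_eq`**, `not_mem_range_algebraMap_of_sq_eq_of_forall_re_neg`.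

HONEST LABEL: HC_CM is proved only modulo the 7 printed citations (2 remaining named inputs: hLiu418 = stmt-HodgeConjecture-24832, h413 =
stmt-HodgeConjecture-24833) until rung 0 closes; glue toward the GENUINE residual (U3-F); proves nothing printed; count-neutral.

## References
* [Neukirch1999] J. Neukirch, *Algebraic Number Theory* (1999), Ch. II (8.1).
-/

set_option autoImplicit false
-- the mandated namespace repeats the single-problem summit's segment (`HodgeConjecture.HodgeConjecture`)
set_option linter.dupNamespace false

noncomputable section

namespace Summit.HodgeConjecture.HodgeConjecture.R90.S3

open Polynomial NumberField

/-! ## §1 Dense embeddings and pinnings re-based along `e` -/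

section Dense

variable {F F₂ K' : Type*} [Field F] [Field F₂] [NonAssocSemiring K'] (e : F ≃+* F₂) (J : F →+* K')

/-- `J ∘ e⁻¹` has the same range as `J`. [folklore] -/
theorem range_comp_ringEquiv_symm : Set.range (J.comp e.symm.toRingHom) = Set.range J := by
  ext y
  constructor
  · rintro ⟨x, rfl⟩
    exact ⟨e.symm x, rfl⟩
  · rintro ⟨x, rfl⟩
    exact ⟨e x, by simp⟩

/-- **A dense embedding stays dense after re-basing along a ring isomorphism**: `DenseRange J → DenseRange (J ∘ e⁻¹)` (the dense `J₀ : F′ → L⁺_v` of the planting,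
and the pinnings `Jᵢ`, re-based on `L′⁺`). [cite: Neukirch1999, Ch. II (8.1)] -/
theorem denseRange_comp_ringEquiv_symm [TopologicalSpace K'] (hJ : DenseRange J) : DenseRange (J.comp e.symm.toRingHom) := by
  rw [DenseRange, range_comp_ringEquiv_symm e J]
  exact hJ

/-- The re-based embedding takes the same values: `(J ∘ e⁻¹)(e x) = J x`. [folklore] -/
theorem comp_ringEquiv_symm_apply (x : F) : (J.comp e.symm.toRingHom) (e x) = J x := by
  simp

end Dense

/-! ## §2 The planted root moves along `e` -/

section Root

variable {F F₂ : Type*} [Field F] [Field F₂] (e : F ≃+* F₂)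

/-- `aeval (e x) g = e (aeval x g)` for `g ∈ ℤ[X]` (Mathlib `aeval_algHom_apply` at the `ℤ`-algebra map `e`). [folklore] -/
theorem aeval_int_ringEquiv_apply (g : ℤ[X]) (x : F) : aeval (e x) g = e (aeval x g) := by
  have h := aeval_algHom_apply (e.toRingHom.toIntAlgHom) x g
  simpa using h

/-- The planted root moves: `aeval (e x) g = 0 ↔ aeval x g = 0` (`g ∈ ℤ[X]`). [folklore] -/
theorem aeval_int_ringEquiv_apply_eq_zero_iff (g : ℤ[X]) (x : F) : aeval (e x) g = 0 ↔ aeval x g = 0 := by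
  rw [aeval_int_ringEquiv_apply, map_eq_zero_iff e e.injective]

/-- `aeval (e x) q = e (aeval x q)` for `q ∈ ℚ[X]` and fields of characteristic zero (★ P7 `algEquiv_ofRingEquiv_rat_apply`). [folklore] -/
theorem aeval_rat_ringEquiv_apply [CharZero F] [CharZero F₂] (q : ℚ[X]) (x : F) : aeval (e x) q = e (aeval x q) := by
  rw [← algEquiv_ofRingEquiv_rat_apply e x, aeval_algHom_apply, algEquiv_ofRingEquiv_rat_apply]

/-- Roots of an integer polynomial read in `F₂` versus `F`: `(g.map (ℤ → F₂)).IsRoot (e x) ↔ (g.map (ℤ → F)).IsRoot x`. [folklore] -/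
theorem isRoot_map_ringEquiv_iff (g : ℤ[X]) (x : F) : (g.map (Int.castRingHom F₂)).IsRoot (e x) ↔ (g.map (Int.castRingHom F)).IsRoot x := by
  have h := aeval_int_ringEquiv_apply_eq_zero_iff e g x
  rwa [aeval_def, aeval_def, algebraMap_int_eq, algebraMap_int_eq, ← eval_map, ← eval_map] at h

end Root

/-! ## §3 The degree -/

/-- **Degree transport**: `[F₂ : ℚ] = [F : ℚ]` along a ring isomorphism of characteristic-zero fields (the `d` of ★ P9′'s exhaustion, read on `L′⁺`). [folklore] -/
theorem finrank_rat_eq_of_ringEquiv {F F₂ : Type*} [Field F] [CharZero F] [Field F₂] [CharZero F₂] (e : F ≃+* F₂) :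
    Module.finrank ℚ F₂ = Module.finrank ℚ F :=
  ((AlgEquiv.ofRingEquiv (f := e) (fun q => by simp) : F ≃ₐ[ℚ] F₂).toLinearEquiv.finrank_eq).symm

/-! ## §4 The square root of a non-square is not in the base field (★ P8c's `hδF`) -/

/-- **`θ ∉ F` for `θ² = γ` with `γ` a non-square of `F`**: if no `b ∈ F` has `b² = γ` and `θ² = algebraMap F K γ` then `θ` is not in the range of `algebraMap F K`
(for a field `K`; injectivity of `algebraMap`). [folklore] -/
theorem not_mem_range_algebraMap_of_sq_eq {F K : Type*} [Field F] [Field K] [Algebra F K] {γ : F} (hγ : ∀ b : F, b ^ 2 ≠ γ) {θ : K}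
    (hθ : θ ^ 2 = algebraMap F K γ) : θ ∉ (algebraMap F K).range := by
  rintro ⟨b, hb⟩
  refine hγ b ((algebraMap F K).injective ?_)
  rw [map_pow, hb, hθ]

/-- **★ P8c's `hδF` for the planted CM field**: over a totally real `F`, a square root of a TOTALLY NEGATIVE `γ` (★ P7 §3: such a `γ` is a non-square) is not in the base
field. [folklore] -/
theorem not_mem_range_algebraMap_of_sq_eq_of_forall_re_neg {F K : Type*} [Field F] [NumberField F] [IsTotallyReal F] [Field K] [Algebra F K] {γ : F}
    (hγ : ∀ σ : F →+* ℂ, (σ γ).re < 0) {θ : K} (hθ : θ ^ 2 = algebraMap F K γ) : θ ∉ (algebraMap F K).range :=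
  not_mem_range_algebraMap_of_sq_eq (forall_sq_ne_of_forall_re_neg hγ) hθ

end Summit.HodgeConjecture.HodgeConjecture.R90.S3

end
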